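import Literature.Computability.Complexity.CodeFPArith
import Literature.Computability.Complexity.TM2PassThrough
import HarnessLib

/-!
# Fixed-width binary fields (tool for THEOREM E♯)

A delimiter-free way to write a number `x ≤ N` inside a machine state when `N` is known to the
reader: `CCode.fld N x = bin (x + 2^{size N})` has EXACTLY `size N + 1` bits (`length_fld`), is
never empty, decodes by `bitsToNat (fld N x) - 2^{size N} = x` (`bitsToNat_fld`), and is polynomial
time on `⟨1ᴺ, bin x⟩` (`codeFP_fld`; `codeFP_size`: `N ↦ size N` in unary).  Used by the names of
`SoloBlindTheoremESharp.lean` to save the `2·size` overhead of self-delimiting pairs.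
All statements proved.

References: S. Arora, B. Barak, *Computational Complexity: A Modern Approach*, CUP 2009, §1.2
(representations; polynomial-time functions are closed under composition).
-/

namespace Summit.PneNP.PneNP.Theorems.SoloBlind

open Literature.Computability.Complexity
open Literature.Computability.Complexity.CodeFP (natE unE bitE pairE rawE strE pairE_apply length_unE)

namespace CCode

/-- The FIXED-WIDTH binary field of `x ≤ N`: `bin (x + 2^{size N})`, of length exactly `size N + 1`
(so that no delimiter is needed). [folklore] -/
def fld (N x : ℕ) : List Bool := natE (x + 2 ^ Nat.size N)

/-- `|fld N x| = size N + 1` for `x ≤ N`. [folklore] -/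
theorem length_fld {N x : ℕ} (hx : x ≤ N) : (fld N x).length = Nat.size N + 1 := by
  have h1 : N < 2 ^ Nat.size N := Nat.lt_size_self N
  have h2 : (fld N x).length = Nat.size (x + 2 ^ Nat.size N) := by
    simp only [fld, CodeFP.natE, TM2Pass.length_encodeNat_eq_size]
  rw [h2]
  apply le_antisymm
  · exact Nat.size_le.2 (by rw [pow_succ]; omega)
  · exact Nat.lt_size.2 (by omega)

/-- `fld N x ≠ []`. [folklore] -/
theorem fld_ne_nil (N x : ℕ) : fld N x ≠ [] := by
  intro h
  have h1 := congrArg List.length h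
  simp only [fld, CodeFP.natE, TM2Pass.length_encodeNat_eq_size, List.length_nil] at h1
  have h2 : 0 < Nat.size (x + 2 ^ Nat.size N) := Nat.size_pos.2 (by positivity)
  omega

/-- Decoding the field: `bitsToNat (fld N x) - 2^{size N} = x`. [folklore] -/
theorem bitsToNat_fld (N x : ℕ) : bitsToNat (fld N x) - 2 ^ Nat.size N = x := by
  rw [fld, CodeFP.bitsToNat_natE]
  omega

/-- `size` is polynomial time in unary (`|bin N|`). [folklore] -/
theorem codeFP_size : CodeFP unE unE Nat.size :=
  (CodeFP.strLength.comp (CodeFP.strOfNat.comp CodeFP.natOfUn)).congr fun N => by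
    simp only [id_eq, CodeFP.natE, TM2Pass.length_encodeNat_eq_size]

/-- `fld` is polynomial time on `⟨1ᴺ, bin x⟩`. [folklore] -/
theorem codeFP_fld : CodeFP (pairE unE natE) strE (fun a => fld a.1 a.2) :=
  (CodeFP.strOfNat.comp (CodeFP.natAdd.comp ((CodeFP.snd unE natE).pair
    (CodeFP.natPow.comp ((CodeFP.const (eβ := natE) _ 2).pair
      (codeFP_size.comp (CodeFP.fst unE natE))))))).congr fun _ => rfl

end CCode

end Summit.PneNP.PneNP.Theorems.SoloBlind
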